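import Literature.Analysis.FluidPDE.ConvexIntegration2DSubsolutions
import HarnessLib

/-!
# Convex integration in 2-D: the perturbation step (CDK 2015, claim (Cl) of §4.1)

Topic `Analysis/FluidPDE`. Support file (layer 4b of 5) for the proof of
`ConvexIntegrationLemma2DBall` (Chiodaroli–De Lellis–Kreml 2015, Lemma 3.7 on a ball): the
*perturbation property* (Cl) of CDK 2015, §4.1, in the quantitative form needed by a
constructive iteration (no Baire category).

* `step` (**claim (Cl)**): for `p ∈ X₀` over a bounded open `Ω`, finitely many `C¹_c` amplitudes
  `f_j` and `ε > 0` there is an increment `w` — a finite sum of localized plane waves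
  (CDK Prop. 4.1) on a disjoint family of balls of `Ω` capturing half of the defect integral,
  along the segments of the geometric lemma (CDK Lemma 4.3, uniform version), with one large
  common frequency — such that `p + w ∈ X₀`, `|∫ wᵢ f_j| ≤ ε` (weakly small), `∫ wᵢ = 0`, and the
  velocity energy gain is `∫ (w₀² + w₁²) ≥ β J(p)² - ε`, `β = stepGain C Ω`, `J` the defect
  (CDK: `liminf ‖ṽ + v_k‖² ≥ ‖ṽ + v̲‖² + β (C|Γ| - ‖ṽ + v̲‖²)²`).

## References

* E. Chiodaroli, C. De Lellis, O. Kreml, *Global ill-posedness of the isentropic system of gas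
  dynamics*, Comm. Pure Appl. Math. 68 (2015) 1157–1190, §4.1 (proof of claim (Cl)).
-/

noncomputable section

open MeasureTheory Set Metric Filter Function
open scoped ContDiff Topology

namespace Literature.Analysis.FluidPDE.ConvexIntegration

/-! ### The perturbation step -/

section Step

variable {C : ℝ} {qt : State} {Ω : Set ST} {p : Fin 4 → ST → ℝ}

/-- The defect of an element of `X₀` is non-negative. [folklore] -/
theorem MemX0.defect_nonneg (hp : MemX0 C qt Ω p) (hΩ : MeasurableSet Ω) : 0 ≤ defect C qt Ω p :=
  setIntegral_nonneg hΩ fun z _ => (hp.inU z).1.le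

/-- **The perturbation step (CDK 2015, claim (Cl) of §4.1), constructive form.** Let `p ∈ X₀`
over a bounded open set `Ω`, let `f_j` (`j` in a finite index type) be compactly supported `C¹`
amplitudes and `ε > 0`. Then there is an increment `w` — a finite sum of localized plane waves
(CDK Prop. 4.1) placed on disjoint balls of `Ω` along the segments of the geometric lemma
(CDK Lemma 4.3), with one large common frequency — such that: `w` is smooth, compactly
supported, solves the linear system, `p + w ∈ X₀`; `|∫ wₖ f_j| ≤ ε` for all `j, k`
(the increment is weakly small); `∫ wₖ = 0`; and the velocity energy gain is at least
`β J(p)² - ε`, `β = stepGain C Ω`, where `J(p) = ∫_Ω (C - |ṽ + v̲|²)` is the defect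
(CDK: `liminf ‖ṽ + v_k‖² ≥ ‖ṽ + v̲‖² + β (C|Γ| - ‖ṽ + v̲‖²)²`).
[cite: ChiodaroliDeLellisKreml2015, §4.1, claim (Cl) and its proof] -/
theorem step (hC : 0 < C) (hqt : InU C qt) (hΩo : IsOpen Ω) (hΩb : Bornology.IsBounded Ω)
    (hp : MemX0 C qt Ω p) {κ : Type*} [Finite κ] (f : κ → ST → ℝ)
    (hf : ∀ j, ContDiff ℝ 1 (f j)) (hfc : ∀ j, HasCompactSupport (f j)) {ε : ℝ} (hε : 0 < ε) :
    ∃ w : Fin 4 → ST → ℝ,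
      (∀ k, ContDiff ℝ ∞ (w k)) ∧ (∀ k, HasCompactSupport (w k)) ∧ SolvesLinear w ∧
      MemX0 C qt Ω (fun k z => p k z + w k z) ∧
      (∀ j k, |∫ z, w k z * f j z| ≤ ε) ∧ (∀ k, ∫ z, w k z = 0) ∧
      stepGain C Ω * defect C qt Ω p ^ 2 - ε ≤ ∫ z, (w 0 z ^ 2 + w 1 z ^ 2) := by
  classical
  haveI := Fintype.ofFinite κ
  have hsC : 0 < Real.sqrt C := Real.sqrt_pos.mpr hC
  have hΩfin : volume Ω ≠ ⊤ := hΩb.measure_lt_top.ne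
  -- (1) uniform geometry on the range of the state map
  obtain ⟨Q, hQc, hQr, hQU⟩ := hp.exists_compact_superset hqt
  obtain ⟨δ, hδ, ρ₀, hρ₀, hgeom⟩ := uniform_geometry hQc hQU
  choose! n μ ℓ hn hμ hℓ hG1 hG2 using hgeom
  -- (2) uniform continuity radius of the state map
  obtain ⟨r₀, hr₀, hunif⟩ := hp.exists_radius hδ
  -- (3) the defect density and the ball family
  set dfn : ST → ℝ := fun z => trM C (stateOf qt p z) with hdfn_def
  have hdc : Continuous dfn := (continuous_trM C).comp hp.continuous_stateOf
  have hdi : IntegrableOn dfn Ω :=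
    (hdc.continuousOn.integrableOn_compact hΩb.isCompact_closure).mono_set subset_closure
  obtain ⟨m, c, r, hrpos, hrlt, hcΩ, hdisj, hhalf⟩ := exists_finite_ball_family hΩo hr₀ hdi
  -- (4) the wave data on each ball
  set qc : Fin m → State := fun i => stateOf qt p (c i) with hqc_def
  have hqc : ∀ i, qc i ∈ Q := fun i => hQr ⟨c i, rfl⟩
  set D : Fin m → WaveData := fun i =>
    ⟨c i, r i, hrpos i, n (qc i), hn (qc i) (hqc i), μ (qc i), ℓ (qc i)⟩ with hD_def
  have hDA : ∀ i, (D i).A = ℓ (qc i) := fun i => rfl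
  have hA0 : ∀ i, 0 ≤ (D i).A := fun i => hℓ _ (hqc i)
  have hdisj' : Pairwise fun i j => Disjoint (ball (D i).c (D i).r) (ball (D j).c (D j).r) :=
    fun i j hij => Set.disjoint_of_subset ball_subset_closedBall ball_subset_closedBall (hdisj hij)
  -- (5) the common frequency
  set ε' : ℝ := ε / (2 * (m + 1)) with hε'_def
  have hε' : 0 < ε' := by positivity
  have hmε' : (m : ℝ) * ε' ≤ ε / 2 := by
    rw [hε'_def, mul_div_assoc', div_le_div_iff₀ (by positivity) (by norm_num)]
    nlinarith
  have hE1 : ∀ᶠ N : ℝ in atTop, ∀ i z, ∃ s : ℝ, |s| ≤ |(D i).A| ∧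
      ∀ k, |(D i).wave N k z - s * (D i).Dvec k| ≤ ρ₀ :=
    eventually_all.2 fun i => (D i).wave_values_eventually hρ₀
  have hE2 : ∀ᶠ N : ℝ in atTop, ∀ i j k, |∫ z, (D i).wave N k z * f j z| ≤ ε' :=
    eventually_all.2 fun i => eventually_all.2 fun j => eventually_all.2 fun k =>
      (D i).wave_integral_mul_eventually (hf j) (hfc j) k hε'
  have hE3 : ∀ᶠ N : ℝ in atTop, ∀ i, |(∫ z, ((D i).wave N 0 z ^ 2 + (D i).wave N 1 z ^ 2))
      - (D i).A ^ 2 / 2 * ∫ z, (D i).cutoff z ^ 2| ≤ ε' :=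
    eventually_all.2 fun i => (D i).wave_energy_eventually hε'
  obtain ⟨N, hN1, hN2, hN3⟩ := (hE1.and (hE2.and hE3)).exists
  -- (6) the increment and its qualitative properties
  have hws : ∀ k, ContDiff ℝ ∞ (waveSum D N k) := contDiff_waveSum D N
  have hwc : ∀ k, HasCompactSupport (waveSum D N k) := hasCompactSupport_waveSum D N
  have hwsol : SolvesLinear (waveSum D N) := solvesLinear_waveSum D N
  have hwΩ : ∀ k, tsupport (waveSum D N k) ⊆ Ω := fun k =>
    (tsupport_waveSum_subset D N k).trans
      (iUnion_subset fun i => ball_subset_closedBall.trans (hcΩ i))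
  refine ⟨waveSum D N, hws, hwc, hwsol, ?_, ?_, ?_, ?_⟩
  · -- `p + w ∈ X₀`
    refine ⟨fun k => (hp.smooth k).add (hws k), fun k => (hp.hasCompactSupport k).add (hwc k),
      fun k => ?_, hp.solves.add hwsol (fun k => differentiable_of_smooth (hp.smooth k))
        (fun k => differentiable_of_smooth (hws k)), fun z => ?_⟩
    · exact (tsupport_add (p k) (waveSum D N k)).trans (union_subset (hp.tsupport_subset k) (hwΩ k))
    · by_cases hz : ∃ i, z ∈ ball (c i) (r i)
      · obtain ⟨i, hi⟩ := hz
        obtain ⟨s, hs, hsk⟩ := hN1 i z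
        have hwz : ∀ k, waveSum D N k z = (D i).wave N k z := fun k => waveSum_eq_of_mem D hdisj' hi
        have hq' : stateOf qt p z ∈ ball (qc i) δ :=
          hunif z (c i) (lt_trans (mem_ball.mp hi) (hrlt i))
        have hsl : |s| ≤ ℓ (qc i) := by rw [hDA i, abs_of_nonneg (hA0 i)] at hs; exact hs
        apply hG2 (qc i) (hqc i) _ hq' s hsl
        rw [mem_closedBall, dist_pi_le_iff hρ₀.le]
        intro k
        rw [Real.dist_eq]
        have : stateOf qt (fun k z => p k z + waveSum D N k z) z k
            - (stateOf qt p z + s • dirVec (n (qc i)) (μ (qc i))) k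
            = (D i).wave N k z - s * (D i).Dvec k := by
          simp only [stateOf_apply, Pi.add_apply, Pi.smul_apply, smul_eq_mul, hwz]
          have hDv : (D i).Dvec k = dirVec (n (qc i)) (μ (qc i)) k := rfl
          rw [hDv]; ring
        rw [this]; exact hsk k
      · push Not at hz
        have hwz : ∀ k, waveSum D N k z = 0 := fun k => waveSum_eq_zero D (fun i => hz i)
        have : stateOf qt (fun k z => p k z + waveSum D N k z) z = stateOf qt p z := by
          ext k; simp [stateOf_apply, hwz]
        rw [this]; exact hp.inU z
  · -- the increment is weakly small
    intro j k
    have hint : ∀ i, Integrable (fun z => (D i).wave N k z * f j z) := fun i =>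
      (((D i).continuous_wave N k).mul (hf j).continuous).integrable_of_hasCompactSupport
        (hfc j).mul_left
    have hsplit : ∫ z, waveSum D N k z * f j z = ∑ i, ∫ z, (D i).wave N k z * f j z := by
      simp only [waveSum, Finset.sum_mul]
      exact integral_finsetSum _ fun i _ => hint i
    rw [hsplit]
    calc |∑ i, ∫ z, (D i).wave N k z * f j z| ≤ ∑ i, |∫ z, (D i).wave N k z * f j z| :=
          Finset.abs_sum_le_sum_abs _ _
      _ ≤ ∑ _i : Fin m, ε' := Finset.sum_le_sum fun i _ => hN2 i j k
      _ = m * ε' := by simp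
      _ ≤ ε := by linarith
  · -- mean zero
    intro k
    simp only [waveSum]
    rw [integral_finsetSum _ fun i _ => ((D i).continuous_wave N k).integrable_of_hasCompactSupport
      ((D i).hasCompactSupport_wave N k)]
    exact Finset.sum_eq_zero fun i _ => (D i).integral_wave_eq_zero N k
  · -- the energy gain
    set V : Fin m → ℝ := fun i => volume.real (ball (c i) (r i)) with hV_def
    have hV0 : ∀ i, 0 ≤ V i := fun i => measureReal_nonneg
    have hVcl : ∀ i, volume.real (closedBall (c i) (r i)) = V i := fun i =>
      volume_real_closedBall_eq (c i) (r i)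
    -- T1: the energy splits over the balls
    have hT1 : ∫ z, (waveSum D N 0 z ^ 2 + waveSum D N 1 z ^ 2)
        = ∑ i, ∫ z, ((D i).wave N 0 z ^ 2 + (D i).wave N 1 z ^ 2) := by
      have hpt : ∀ z, waveSum D N 0 z ^ 2 + waveSum D N 1 z ^ 2
          = ∑ i, ((D i).wave N 0 z ^ 2 + (D i).wave N 1 z ^ 2) := fun z => by
        rw [Finset.sum_add_distrib, waveSum_sq D hdisj' N 0 z, waveSum_sq D hdisj' N 1 z]
      simp_rw [hpt]
      exact integral_finsetSum _ fun i _ => (D i).integrable_energy N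
    -- T2: lower bound on each ball
    have hball : ∀ i, (D i).A ^ 2 * V i / 16 - ε'
        ≤ ∫ z, ((D i).wave N 0 z ^ 2 + (D i).wave N 1 z ^ 2) := by
      intro i
      have h3 := (abs_le.mp (hN3 i)).1
      have hχ := (D i).volume_half_ball_le_integral_cutoff_sq
      have hhalf' : volume.real (ball (D i).c ((D i).r / 2)) = V i / 8 :=
        volume_real_ball_half (c i) (hrpos i).le
      rw [hhalf'] at hχ
      have hA2 : 0 ≤ (D i).A ^ 2 / 2 := by positivity
      nlinarith [mul_le_mul_of_nonneg_left hχ hA2]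
    have hT23 : (∑ i, (D i).A ^ 2 * V i) / 16 - m * ε'
        ≤ ∫ z, (waveSum D N 0 z ^ 2 + waveSum D N 1 z ^ 2) := by
      rw [hT1]
      have := Finset.sum_le_sum fun i (_ : i ∈ Finset.univ) => hball i
      simp only [Finset.sum_sub_distrib, Finset.sum_const, Finset.card_univ, Fintype.card_fin,
        nsmul_eq_mul] at this
      rw [Finset.sum_div]
      have e : ∑ i, (D i).A ^ 2 * V i / 16 = ∑ i, (D i).A ^ 2 * V i / 16 := rfl
      linarith
    -- T4: the defect is controlled by `∑ Aᵢ Vᵢ`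
    have hT4 : defect C qt Ω p / 2 ≤ 16 * Real.sqrt C * ∑ i, (D i).A * V i := by
      have hle : ∀ i, ∫ z in closedBall (c i) (r i), dfn z ≤ 16 * Real.sqrt C * (D i).A * V i := by
        intro i
        have hbd : ∀ z ∈ closedBall (c i) (r i), dfn z ≤ 16 * Real.sqrt C * (D i).A := by
          intro z hz
          have hq' : stateOf qt p z ∈ ball (qc i) δ :=
            hunif z (c i) (lt_of_le_of_lt (mem_closedBall.mp hz) (hrlt i))
          have := hG1 (qc i) (hqc i) _ hq'
          rw [div_le_iff₀ (by positivity)] at this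
          rw [hDA]
          show trM C (stateOf qt p z) ≤ _
          linarith
        calc ∫ z in closedBall (c i) (r i), dfn z
            ≤ ∫ z in closedBall (c i) (r i), (16 * Real.sqrt C * (D i).A) :=
              setIntegral_mono_on (hdi.mono_set (hcΩ i))
                ((integrableOn_const_iff).mpr (Or.inr measure_closedBall_lt_top))
                measurableSet_closedBall hbd
          _ = 16 * Real.sqrt C * (D i).A * V i := by
              rw [setIntegral_const, smul_eq_mul, hVcl]; ring
      calc defect C qt Ω p / 2 = (∫ z in Ω, dfn z) / 2 := rfl
        _ ≤ ∑ i, ∫ z in closedBall (c i) (r i), dfn z := hhalf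
        _ ≤ ∑ i, 16 * Real.sqrt C * (D i).A * V i := Finset.sum_le_sum fun i _ => hle i
        _ = 16 * Real.sqrt C * ∑ i, (D i).A * V i := by
            rw [Finset.mul_sum]; exact Finset.sum_congr rfl fun i _ => by ring
    -- T5: Cauchy–Schwarz and the total volume of the balls
    have hVsum : ∑ i, V i ≤ volume.real Ω := by
      have hpd : PairwiseDisjoint (↑(Finset.univ : Finset (Fin m)))
          (fun i => closedBall (c i) (r i)) := fun i _ j _ hij => hdisj hij
      have heq := measureReal_biUnion_finset (μ := volume) hpd
        (fun i _ => measurableSet_closedBall) (fun i _ => measure_closedBall_lt_top.ne)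
      calc ∑ i, V i = ∑ i, volume.real (closedBall (c i) (r i)) := by simp only [hVcl]
        _ = volume.real (⋃ i ∈ (Finset.univ : Finset (Fin m)), closedBall (c i) (r i)) := heq.symm
        _ ≤ volume.real Ω := measureReal_mono (iUnion₂_subset fun i _ => hcΩ i) hΩfin
    have hCS : (∑ i, (D i).A * V i) ^ 2 ≤ (∑ i, (D i).A ^ 2 * V i) * ∑ i, V i := by
      have h := Finset.sum_mul_sq_le_sq_mul_sq Finset.univ
        (fun i => (D i).A * Real.sqrt (V i)) (fun i => Real.sqrt (V i))
      have e1 : ∀ i, (D i).A * Real.sqrt (V i) * Real.sqrt (V i) = (D i).A * V i := fun i => by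
        rw [mul_assoc, Real.mul_self_sqrt (hV0 i)]
      have e2 : ∀ i, ((D i).A * Real.sqrt (V i)) ^ 2 = (D i).A ^ 2 * V i := fun i => by
        rw [mul_pow, Real.sq_sqrt (hV0 i)]
      have e3 : ∀ i, Real.sqrt (V i) ^ 2 = V i := fun i => Real.sq_sqrt (hV0 i)
      simp only [e1, e2, e3] at h
      exact h
    -- T6: conclusion
    have hJ0 : 0 ≤ defect C qt Ω p := hp.defect_nonneg hΩo.measurableSet
    set J := defect C qt Ω p
    set S1 := ∑ i, (D i).A * V i
    set S2 := ∑ i, (D i).A ^ 2 * V i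
    have hS1 : 0 ≤ S1 := Finset.sum_nonneg fun i _ => mul_nonneg (hA0 i) (hV0 i)
    have hS2 : 0 ≤ S2 := Finset.sum_nonneg fun i _ => mul_nonneg (sq_nonneg _) (hV0 i)
    have hI0 : 0 ≤ ∫ z, (waveSum D N 0 z ^ 2 + waveSum D N 1 z ^ 2) :=
      integral_nonneg fun z => by positivity
    by_cases hvol : volume.real Ω = 0
    · have : stepGain C Ω = 0 := by simp [stepGain, hvol]
      rw [this, zero_mul]
      linarith
    · have hvolpos : 0 < volume.real Ω := lt_of_le_of_ne measureReal_nonneg (Ne.symm hvol)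
      have h1 : J ^ 2 ≤ 1024 * C * S1 ^ 2 := by
        have hJle : J ≤ 32 * Real.sqrt C * S1 := by linarith
        calc J ^ 2 ≤ (32 * Real.sqrt C * S1) ^ 2 := pow_le_pow_left₀ hJ0 hJle 2
          _ = 1024 * C * S1 ^ 2 := by rw [mul_pow, mul_pow, Real.sq_sqrt hC.le]; ring
      have h2 : S1 ^ 2 ≤ S2 * volume.real Ω := hCS.trans (mul_le_mul_of_nonneg_left hVsum hS2)
      have key : stepGain C Ω * J ^ 2 ≤ S2 / 16 := by
        simp only [stepGain]
        rw [inv_mul_eq_div, div_le_div_iff₀ (by positivity) (by norm_num)]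
        nlinarith [mul_le_mul_of_nonneg_left h2 (by positivity : (0 : ℝ) ≤ 16384 * C)]
      linarith

end Step

end Literature.Analysis.FluidPDE.ConvexIntegration
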